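import Summits.BirchSwinnertonDyer.BirchSwinnertonDyer.Theorems.AlignedTransportAtTwoMainConjectureOfRankZeroBSDAtTwoSelmerLayerDuality
import HarnessLib

/-!
# Route `AlignedTransportAtTwo`, crux C2 `MainConjectureOfRankZeroBSDAtTwo` (stmt-BirchSwinnertonDyer-22298):
# THE `p`-TORSION COUNT AT EVERY LAYER — `#X/(ω_n, p)X = #Sel_∞^{Γ_n}[p]`
# (unconditional: every number field `K`, every `ℤ_p`-extension `κ`, every Pontryagin-dual datum, every `n`)

HONEST FRAMING (cell `bsd-f1-sign2`, WIDTH-5 attached prover seat `bsd-line-att-p5` gen 43 on line `birth` of the lead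
`bsd-line-att-p2`; `--supports` stmt-BirchSwinnertonDyer-22298, closes nothing; BSD is NOT proved by any of this; the crux
C2, its verdict «blocked-on `Rank1Residual.GreenbergMuConjectureIrreducible`» and every registered stub are untouched).
THEOREMS ONLY — no `def`, no instance, no named fact, no `sorry`. First half of the lineage's SELMER RANK-JUMP `μ`-DOOR
(second half: `…SelmerLayerMuDoor`, which feeds this count into the `Λ`-module criterion
`Literature.NumberTheory.IwasawaTheory.IwasawaModuleRankJump.muInvariant_eq_zero_of_card_layerQuotient_lt`:
`#X/(ω_k,p)X · p^{p^j} < #X/(ω_j,p)X · p^{p^k}` for one pair `j < k` ⟹ `μ(X) = 0`).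

g40's `…SelmerLayerDuality` gives Pontryagin duality at layer `n`, `X/ω_nX ≃+ Hom(Sel_∞^{Γ_n}, ℚ/ℤ)`; reducing mod `p`:

* §1 (any abelian group `B`): `exists_eq_zsmul_of_forall_mem_torsionBy` — a character of `B` vanishing on `B[p]` is a
  `p`-th multiple (it factors through `B/B[p] ≅ pB` and extends from `pB` by injectivity of `ℚ/ℤ`);
  ★ `natCard_modN_characterModule_eq` — **`#(Hom(B, ℚ/ℤ)/p) = #B[p]`** (`B[p]` finite): restriction
  `Hom(B,ℚ/ℤ)/p → Hom(B[p], ℚ/ℤ)` is a bijection (onto: tree `ZpCorank`; into: §1), and `#Hom(V, ℚ/ℤ) = #V` for a finite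
  `𝔽_p`-space (tree `ZpCorank.natCard_characterModule`).
* §2 (`W/K` elliptic over a number field, `κ` a `ℤ_p`-extension with topological generator `γ`, `D` a Pontryagin-dual datum
  with `X = D.X` finitely generated over `Λ`, any `n`; `ω_n = (1+T)^{pⁿ} − 1`):
  `finite_torsionBy_selmerInvariants` (`Sel_∞^{Γ_n}[p]` is finite);
  ★★ `natCard_layerQuotientP_eq_natCard_torsionBy_selmerInvariants` —
  **`#(X/(ω_n, p)X) = #Sel_∞^{Γ_n}[p]`** (`X/(ω_n,p)X = (X/ω_nX)/p ≃ Hom(Sel_∞^{Γ_n}, ℚ/ℤ)/p`, then §1).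

References: R. Greenberg, LNM 1716 (1999), §1 pp. 60–62, §3 p. 85 [GreenbergLNM1716]; L. Washington, GTM 83, §13.2,
§13.4 [Washington1997]; B. Mazur, Invent. Math. 18 (1972), §6 [Mazur1972].
-/

set_option linter.dupNamespace false
set_option autoImplicit false

noncomputable section

open scoped Classical AddSubgroup

universe u

namespace Summit.BirchSwinnertonDyer.BirchSwinnertonDyer.Theorems.AlignedTransportAtTwoSelmerLayerMuDoorCount

open WeierstrassCurve Literature.NumberTheory.EllipticCurves Literature.NumberTheory.EllipticCurves.IwasawaDual
  Literature.NumberTheory.EllipticCurves.IwasawaAlgebra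
  Summit.BirchSwinnertonDyer.BirchSwinnertonDyer.Theorems.AlignedTransportAtTwoSelmerLayerModel
  Summit.BirchSwinnertonDyer.BirchSwinnertonDyer.Theorems.AlignedTransportAtTwoSelmerLayerDuality

/-! ## §1 `Hom(B, ℚ/ℤ)/p ≅ Hom(B[p], ℚ/ℤ)` and `#(Hom(B, ℚ/ℤ)/p) = #B[p]` -/

section Pontryagin

variable {B : Type u} [AddCommGroup B] (p : ℕ) [hp : Fact p.Prime]

omit hp in
/-- **A character of `B` vanishing on `B[p]` is a `p`-th multiple**: it factors through `B/B[p]`, which multiplication by `p`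
identifies with `pB ≤ B`, and the resulting character of `pB` extends to `B` (`ℚ/ℤ` is injective). [folklore] -/
theorem exists_eq_zsmul_of_forall_mem_torsionBy (χ : CharacterModule B) (hχ : ∀ b ∈ B[(p : ℤ)], χ b = 0) :
    ∃ ψ : CharacterModule B, χ = (p : ℤ) • ψ := by
  -- `φ = p·` on `B`, `ker φ = B[p] ≤ ker χ`
  set φ : B →+ B := DistribSMul.toAddMonoidHom B (p : ℕ) with hφdef
  have hφ : ∀ b : B, φ b = p • b := fun _ ↦ rfl
  have hker : ∀ b ∈ φ.ker, χ b = 0 := by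
    intro b hb
    rw [AddMonoidHom.mem_ker, hφ] at hb
    exact hχ b (AddSubgroup.torsionBy.nsmul_iff.mpr hb)
  -- `χ̄ : B/ker φ → ℚ/ℤ`, `e : B/ker φ ≃ pB`, `ψ₀ = χ̄ ∘ e⁻¹ : pB → ℚ/ℤ`
  set χbar : B ⧸ φ.ker →+ AddCircle (1 : ℚ) := QuotientAddGroup.lift φ.ker χ hker with hχbar
  set e : B ⧸ φ.ker ≃+ φ.range := QuotientAddGroup.quotientKerEquivRange φ with he
  set ψ₀ : φ.range →+ AddCircle (1 : ℚ) := χbar.comp e.symm.toAddMonoidHom with hψ₀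
  -- extend `ψ₀` to `B`
  obtain ⟨ψ, hψ⟩ := CharacterModule.dual_surjective_of_injective (φ.range.subtype.toIntLinearMap)
    (fun a b h ↦ Subtype.ext h) ψ₀
  refine ⟨ψ, ?_⟩
  ext b
  have hmem : φ b ∈ φ.range := ⟨b, rfl⟩
  -- `(p • ψ) b = ψ (p • b) = ψ₀ ⟨φ b⟩ = χ̄ (e⁻¹ ⟨φ b⟩) = χ̄ (mk b) = χ b`
  have h1 : ((p : ℤ) • ψ) b = ψ (φ b) := by
    rw [show ((p : ℤ) • ψ) b = (p : ℤ) • ψ b from rfl, ← map_zsmul, natCast_zsmul, hφ]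
  have h2 : ψ (φ b) = ψ₀ ⟨φ b, hmem⟩ := by
    rw [← hψ]
    rfl
  have h3 : e.symm ⟨φ b, hmem⟩ = QuotientAddGroup.mk b := by
    rw [AddEquiv.symm_apply_eq]
    rfl
  rw [h1, h2, hψ₀, AddMonoidHom.comp_apply, AddEquiv.coe_toAddMonoidHom, h3, hχbar, QuotientAddGroup.lift_mk]
  rfl

/-- **`#(Hom(B, ℚ/ℤ)/p) = #B[p]`** for an abelian group with `B[p]` finite: the restriction `Hom(B, ℚ/ℤ)/p → Hom(B[p], ℚ/ℤ)`
is onto (characters of a subgroup extend) and into (§1), and `#Hom(V, ℚ/ℤ) = #V` for the finite `𝔽_p`-space `V = B[p]`.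
[cite: Washington1997, §13.4 (Pontryagin duality bookkeeping)] -/
theorem natCard_modN_characterModule_eq [Finite (B[(p : ℤ)])] :
    Nat.card (ModN (CharacterModule B) p) = Nat.card (B[(p : ℤ)]) := by
  letI : Module (ZMod p) (B[(p : ℤ)]) := AddSubgroup.torsionBy.zmodModule
  -- the restriction map `r : Hom(B,ℚ/ℤ)/p → Hom(B[p], ℚ/ℤ)`
  let r : ModN (CharacterModule B) p →+ CharacterModule (B[(p : ℤ)]) :=
    ModN.liftEquiv.symm
      ⟨(CharacterModule.dual ((B[(p : ℤ)]).subtype.toIntLinearMap)).toAddMonoidHom, fun χ ↦ by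
        refine AddMonoidHom.ext fun b ↦ ?_
        show p • χ (b : B) = 0
        rw [← map_nsmul, ← AddSubgroupClass.coe_nsmul, AddSubgroup.torsionBy.nsmul b,
          ZeroMemClass.coe_zero, map_zero]⟩
  have hr : ∀ (χ : CharacterModule B) (b : B[(p : ℤ)]), r (ModN.mkQ p χ) b = χ b := fun _ _ ↦ rfl
  have hsurj : Function.Surjective r := by
    intro ψ
    obtain ⟨χ, hχ⟩ := CharacterModule.dual_surjective_of_injective
      ((B[(p : ℤ)]).subtype.toIntLinearMap) (fun a b h ↦ Subtype.ext h) ψ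
    refine ⟨ModN.mkQ p χ, CharacterModule.ext (A := B[(p : ℤ)]) fun b ↦ ?_⟩
    rw [hr, ← hχ]
    rfl
  have hinj : Function.Injective r := by
    intro x y hxy
    induction x using QuotientAddGroup.induction_on with
    | H χ =>
      induction y using QuotientAddGroup.induction_on with
      | H χ' =>
        -- `χ - χ'` vanishes on `B[p]`, hence is a `p`-th multiple
        have hzero : ∀ b ∈ B[(p : ℤ)], (χ - χ') b = 0 := by
          intro b hb
          have h := DFunLike.congr_fun hxy ⟨b, hb⟩
          change r (ModN.mkQ p χ) ⟨b, hb⟩ = r (ModN.mkQ p χ') ⟨b, hb⟩ at h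
          rw [hr, hr] at h
          change χ b - χ' b = 0
          rw [h, sub_self]
        obtain ⟨ψ, hψ⟩ := exists_eq_zsmul_of_forall_mem_torsionBy p (χ - χ') hzero
        change ModN.mkQ p χ = ModN.mkQ p χ'
        rw [← sub_eq_zero, ← map_sub]
        exact (Submodule.Quotient.mk_eq_zero _).mpr (LinearMap.mem_range.mpr ⟨ψ, hψ.symm⟩)
  rw [Nat.card_congr (Equiv.ofBijective r ⟨hinj, hsurj⟩), ZpCorank.natCard_characterModule p]

end Pontryagin

/-! ## §2 `#X/(ω_n, p)X = #Sel_∞^{Γ_n}[p]` at every layer -/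

section LayerCount

variable (p : ℕ) [hp : Fact p.Prime] {K : Type u} [Field K] [NumberField K] (W : WeierstrassCurve K)
  (κ : ZpExtension K p) {γ : Field.absoluteGaloisGroup K}

/-- **`Sel_∞^{Γ_n}[p]` is finite** (its character group `X/(ω_n, p)X` is a finitely generated `ℤ_p`-module mod `p`;
g40's `X/ω_nX ≃+ Hom(Sel_∞^{Γ_n}, ℚ/ℤ)` and the tree's `finite_torsionBy_of_addEquiv_characterModule`).
[cite: GreenbergLNM1716, §1 pp. 60–62] -/
theorem finite_torsionBy_selmerInvariants (hγ : κ.IsTopGenerator γ) (D : W.SelmerDualData κ γ)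
    [Module.Finite (IwasawaAlgebra p) D.X] (n : ℕ) :
    Finite ((↥(W.selmerInfty κ ⊓ W.layerInvariants κ n))[(p : ℤ)]) := by
  obtain ⟨Ψ, -⟩ := exists_addEquiv_layerQuotient_characterModule_selmerInvariants p W κ hγ D n
  letI : Module ℤ_[p] (D.X ⧸ (Ideal.span {((1 + PowerSeries.X : PowerSeries ℤ_[p]) ^ (p ^ n) - 1 : IwasawaAlgebra p)} •
      ⊤ : Submodule (IwasawaAlgebra p) D.X)) := Module.compHom _ (algebraMap ℤ_[p] (IwasawaAlgebra p))
  haveI : Module.Finite ℤ_[p] (D.X ⧸ (Ideal.span {((1 + PowerSeries.X : PowerSeries ℤ_[p]) ^ (p ^ n) - 1 :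
      IwasawaAlgebra p)} • ⊤ : Submodule (IwasawaAlgebra p) D.X)) :=
    module_finite_int_quotient p _ (module_finite_int_quotient_omega p n)
  exact finite_torsionBy_of_addEquiv_characterModule p Ψ

/-- ★★ **`#(X/(ω_n, p)X) = #Sel_∞^{Γ_n}[p]`** for every number field `K`, every `ℤ_p`-extension `κ` with topological generator
`γ`, every Pontryagin-dual datum `D` with `X = D.X` finitely generated over `Λ`, every `n` (`ω_n = (1+T)^{pⁿ} − 1`):
`X/(ω_n, p)X = (X/ω_nX)/p ≃ Hom(Sel_∞^{Γ_n}, ℚ/ℤ)/p ≃ Hom(Sel_∞^{Γ_n}[p], ℚ/ℤ)`, of order `#Sel_∞^{Γ_n}[p]`. This is the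
quantity `#Q'_n` of the `Λ`-module rank-jump criterion (`IwasawaModuleRankJump`), read on the Selmer side.
[cite: GreenbergLNM1716, §1 pp. 60–62 and §3 p. 85] [cite: Washington1997, §13.4] -/
theorem natCard_layerQuotientP_eq_natCard_torsionBy_selmerInvariants (hγ : κ.IsTopGenerator γ) (D : W.SelmerDualData κ γ)
    [Module.Finite (IwasawaAlgebra p) D.X] (n : ℕ) :
    Nat.card (D.X ⧸ (Ideal.span {((1 + PowerSeries.X : PowerSeries ℤ_[p]) ^ (p ^ n) - 1 : IwasawaAlgebra p)} ⊔ augIdealP p) •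
        (⊤ : Submodule (IwasawaAlgebra p) D.X)) =
      Nat.card ((↥(W.selmerInfty κ ⊓ W.layerInvariants κ n))[(p : ℤ)]) := by
  haveI := finite_torsionBy_selmerInvariants p W κ hγ D n
  obtain ⟨Ψ, -⟩ := exists_addEquiv_layerQuotient_characterModule_selmerInvariants p W κ hγ D n
  set A : Submodule (IwasawaAlgebra p) D.X :=
    Ideal.span {((1 + PowerSeries.X : PowerSeries ℤ_[p]) ^ (p ^ n) - 1 : IwasawaAlgebra p)} • ⊤ with hA
  set P : Submodule (IwasawaAlgebra p) D.X := augIdealP p • ⊤ with hP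
  -- `X/(A ⊔ P) ≃ (X/A)/p(X/A)`
  have hsup : (Ideal.span {((1 + PowerSeries.X : PowerSeries ℤ_[p]) ^ (p ^ n) - 1 : IwasawaAlgebra p)} ⊔ augIdealP p) •
      (⊤ : Submodule (IwasawaAlgebra p) D.X) = A ⊔ P := Submodule.sup_smul _ _ _
  have hmap : (A ⊔ P).map A.mkQ = augIdealP p • (⊤ : Submodule (IwasawaAlgebra p) (D.X ⧸ A)) := by
    rw [Submodule.map_sup, Submodule.mkQ_map_self, bot_sup_eq, hP, Submodule.map_smul'', Submodule.map_top,
      Submodule.range_mkQ]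
  have h1 : Nat.card (D.X ⧸ (Ideal.span {((1 + PowerSeries.X : PowerSeries ℤ_[p]) ^ (p ^ n) - 1 : IwasawaAlgebra p)} ⊔
        augIdealP p) • (⊤ : Submodule (IwasawaAlgebra p) D.X)) =
      Nat.card ((D.X ⧸ A) ⧸ augIdealP p • (⊤ : Submodule (IwasawaAlgebra p) (D.X ⧸ A))) := by
    rw [hsup, ← hmap]
    exact (Nat.card_congr (Submodule.quotientQuotientEquivQuotient A (A ⊔ P) le_sup_left).toEquiv).symm
  -- `p(X/A)` in the `Λ`-structure is the range of multiplication by `p`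
  have hC : ∀ m : D.X ⧸ A, (PowerSeries.C (p : ℤ_[p]) : IwasawaAlgebra p) • m = (p : ℤ) • m := by
    intro m
    rw [map_natCast, Nat.cast_smul_eq_nsmul, natCast_zsmul]
  have h2 : (augIdealP p • (⊤ : Submodule (IwasawaAlgebra p) (D.X ⧸ A))).toAddSubgroup =
      (LinearMap.range (LinearMap.lsmul ℤ (D.X ⧸ A) (p : ℤ))).toAddSubgroup := by
    ext y
    rw [Submodule.mem_toAddSubgroup, Submodule.mem_toAddSubgroup, LinearMap.mem_range]
    change y ∈ Ideal.span {(PowerSeries.C (p : ℤ_[p]) : IwasawaAlgebra p)} • (⊤ : Submodule (IwasawaAlgebra p) (D.X ⧸ A)) ↔ _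
    rw [Submodule.ideal_span_singleton_smul, Submodule.mem_smul_pointwise_iff_exists]
    constructor
    · rintro ⟨m, -, rfl⟩
      exact ⟨m, by rw [LinearMap.lsmul_apply, hC]⟩
    · rintro ⟨m, rfl⟩
      exact ⟨m, Submodule.mem_top, by rw [LinearMap.lsmul_apply, hC]⟩
  have h3 : Nat.card ((D.X ⧸ A) ⧸ augIdealP p • (⊤ : Submodule (IwasawaAlgebra p) (D.X ⧸ A))) =
      Nat.card (ModN (D.X ⧸ A) p) :=
    congrArg (fun H : AddSubgroup (D.X ⧸ A) ↦ Nat.card ((D.X ⧸ A) ⧸ H)) h2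
  -- transport along `Ψ` and count characters of `Sel_∞^{Γ_n}[p]`
  rw [h1, h3, Nat.card_congr (modNEquiv Ψ p).toEquiv, natCard_modN_characterModule_eq p]

end LayerCount

end Summit.BirchSwinnertonDyer.BirchSwinnertonDyer.Theorems.AlignedTransportAtTwoSelmerLayerMuDoorCount

end
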